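import Summits.CriticalPhenomena.PercolationContinuityZ3.Theorems.PercNearOneGluingNoHeavyLowerTailLaminarLonelyRelayTools
import HarnessLib

/-!
# `NoHeavyLowerTail` (stmt-CriticalPhenomena-4575) — the LAMINAR LONELY RELAY theorem, local induction

Support file (factory prove seat `prim-ineq-prove-3`, gen 3; `--supports stmt-CriticalPhenomena-4575`); no
definitions, no named facts.  `μ = prodBernoulli w` on `Fin n`, relays `A`, observer `o`, `S = C(o) ∩ A`
(`= A.filter (o ↔ ·)`), a LAMINAR family `𝓛` of nonempty subsets of `A` (any two members nested or disjoint);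
for `R ∈ 𝓛`: `sub R` = the members inside `R`, `children R` = the maximal members strictly inside `R`,
`D_R = {R ↮ A∖R}`, `E_R = {o ↔ R}`, `φ(R) = μ(D_R ∩ E_R)/μ(D_R)`, and for a set `𝒜` of supersets of `R` the
side event `J(𝒜) = {every Q ∈ 𝒜 is joined to A∖Q}`.
* laminar combinatorics (`children_*`, `sub_eq_insert_biUnion`, `sum_sub_eq`);
* `local_bound` — **the localized laminar lonely relay inequality**: for all relays pairwise separated with
  positive probability, every `R ∈ 𝓛` and every `𝒜` of supersets of `R` there is a member `L ⊆ R` with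
  `Σ_{R' ∈ sub R} μ(S = R', J(𝒜)) ≤ φ(R) · μ({L ↮ A∖R} ∩ J(𝒜))`.
  Proof: induction on `|sub R|`; split by `D_R`: on `D_R` the events `{S = R'}` are disjoint pieces of
  `D_R ∩ E_R ∩ J` and two-set BHK (`iso_reach_side_le`) gives `φ(R) μ(D_R ∩ J)`; off `D_R` the members below each
  child `T` are handled by the induction hypothesis with the side event `J(𝒜 ∪ {R})`, and Kozma–Nitzan Lemma 2
  (`lemma2_blocks_ratio`: `Σ_T φ(T) ≤ φ(R)`) recombines.
-/

namespace Summit.CriticalPhenomena.PercolationContinuityZ3.Theorems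

open scoped BigOperators Classical
open MeasureTheory Set
open Literature.Probability.LatticeModels (prodBernoulli)
open Literature.Probability.Percolation

variable {n : ℕ}

namespace TwoLevelLonelyRelay

/-! ### Laminar combinatorics -/

/-- Children (maximal members strictly inside `R`) are members strictly inside `R`. [folklore] -/
theorem children_mem {𝓛 : Finset (Finset (Fin n))} {R T : Finset (Fin n)}
    (hT : T ∈ 𝓛.filter (fun T => T ⊆ R ∧ T ≠ R ∧ ∀ T' ∈ 𝓛, T ⊆ T' → T' ⊆ R → T' ≠ R → T' = T)) :
    T ∈ 𝓛 ∧ T ⊆ R ∧ T ≠ R ∧ ∀ T' ∈ 𝓛, T ⊆ T' → T' ⊆ R → T' ≠ R → T' = T := by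
  have h := Finset.mem_filter.1 hT
  exact ⟨h.1, h.2.1, h.2.2.1, h.2.2.2⟩

/-- In a laminar family, distinct children of `R` are disjoint. [folklore] -/
theorem children_disjoint {𝓛 : Finset (Finset (Fin n))}
    (hlam : ∀ R ∈ 𝓛, ∀ T ∈ 𝓛, R ⊆ T ∨ T ⊆ R ∨ Disjoint R T) {R : Finset (Fin n)} :
    ∀ T ∈ 𝓛.filter (fun T => T ⊆ R ∧ T ≠ R ∧ ∀ T' ∈ 𝓛, T ⊆ T' → T' ⊆ R → T' ≠ R → T' = T),
      ∀ T' ∈ 𝓛.filter (fun T => T ⊆ R ∧ T ≠ R ∧ ∀ T' ∈ 𝓛, T ⊆ T' → T' ⊆ R → T' ≠ R → T' = T),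
        T ≠ T' → Disjoint T T' := by
  intro T hT T' hT' hne
  obtain ⟨hT𝓛, hTR, hTne, hTmax⟩ := children_mem hT
  obtain ⟨hT'𝓛, hT'R, hT'ne, hT'max⟩ := children_mem hT'
  rcases hlam T hT𝓛 T' hT'𝓛 with h | h | h
  · exact absurd (hTmax T' hT'𝓛 h hT'R hT'ne) hne.symm
  · exact absurd (hT'max T hT𝓛 h hTR hTne) hne
  · exact h

/-- Every member strictly inside `R` lies below a child of `R`. [folklore] -/
theorem exists_child_superset {𝓛 : Finset (Finset (Fin n))} {R R' : Finset (Fin n)} (hR' : R' ∈ 𝓛)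
    (hR'R : R' ⊆ R) (hne : R' ≠ R) :
    ∃ T ∈ 𝓛.filter (fun T => T ⊆ R ∧ T ≠ R ∧ ∀ T' ∈ 𝓛, T ⊆ T' → T' ⊆ R → T' ≠ R → T' = T), R' ⊆ T := by
  have hmem : R' ∈ 𝓛.filter (fun T => T ⊆ R ∧ T ≠ R) := Finset.mem_filter.2 ⟨hR', hR'R, hne⟩
  obtain ⟨T, hT, hR'T, hmax⟩ := exists_maximal_mem_superset (𝓛.filter (fun T => T ⊆ R ∧ T ≠ R)) hmem
  obtain ⟨hT𝓛, hTR, hTne⟩ := Finset.mem_filter.1 hT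
  refine ⟨T, Finset.mem_filter.2 ⟨hT𝓛, hTR, hTne, fun T' hT' hTT' hT'R hT'ne => ?_⟩, hR'T⟩
  exact hmax T' (Finset.mem_filter.2 ⟨hT', hT'R, hT'ne⟩) hTT'

/-- The members inside `R` are `R` together with the members inside its children (disjointly). [folklore] -/
theorem sub_eq_insert_biUnion {𝓛 : Finset (Finset (Fin n))} {R : Finset (Fin n)} (hR : R ∈ 𝓛) :
    𝓛.filter (fun R' => R' ⊆ R) = insert R
      ((𝓛.filter (fun T => T ⊆ R ∧ T ≠ R ∧ ∀ T' ∈ 𝓛, T ⊆ T' → T' ⊆ R → T' ≠ R → T' = T)).biUnion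
        (fun T => 𝓛.filter (fun R' => R' ⊆ T))) := by
  ext R'
  simp only [Finset.mem_insert, Finset.mem_biUnion, Finset.mem_filter]
  constructor
  · rintro ⟨hR'𝓛, hR'R⟩
    by_cases h : R' = R
    · exact Or.inl h
    · obtain ⟨T, hT, hR'T⟩ := exists_child_superset hR'𝓛 hR'R h
      exact Or.inr ⟨T, Finset.mem_filter.1 hT, hR'𝓛, hR'T⟩
  · rintro (rfl | ⟨T, hT, hR'𝓛, hR'T⟩)
    · exact ⟨hR, Finset.Subset.refl _⟩
    · exact ⟨hR'𝓛, hR'T.trans hT.2.1⟩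

/-- Sum over the members inside `R` = the term of `R` plus the sums over the members inside each child.
[folklore] -/
theorem sum_sub_eq {𝓛 : Finset (Finset (Fin n))}
    (hlam : ∀ R ∈ 𝓛, ∀ T ∈ 𝓛, R ⊆ T ∨ T ⊆ R ∨ Disjoint R T) (hne𝓛 : ∀ R ∈ 𝓛, R.Nonempty)
    {R : Finset (Fin n)} (hR : R ∈ 𝓛) (f : Finset (Fin n) → ℝ) :
    ∑ R' ∈ 𝓛.filter (fun R' => R' ⊆ R), f R' = f R +
      ∑ T ∈ 𝓛.filter (fun T => T ⊆ R ∧ T ≠ R ∧ ∀ T' ∈ 𝓛, T ⊆ T' → T' ⊆ R → T' ≠ R → T' = T),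
        ∑ R' ∈ 𝓛.filter (fun R' => R' ⊆ T), f R' := by
  rw [sub_eq_insert_biUnion hR, Finset.sum_insert, Finset.sum_biUnion]
  · -- pairwise disjointness of the sub-families below distinct children
    intro T hT T' hT' hne
    simp only [Function.onFun]
    refine Finset.disjoint_left.2 fun R' hR'T hR'T' => hne ?_
    have h1 := (Finset.mem_filter.1 hR'T); have h2 := (Finset.mem_filter.1 hR'T')
    by_contra hTT
    have hdis := children_disjoint hlam T (Finset.mem_coe.1 hT) T' (Finset.mem_coe.1 hT') hTT
    obtain ⟨x, hx⟩ := hne𝓛 R' h1.1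
    exact (Finset.disjoint_left.1 hdis) (h1.2 hx) (h2.2 hx)
  · -- `R` is not below any child
    simp only [Finset.mem_biUnion, Finset.mem_filter, not_exists, not_and]
    intro T hT _ hRT
    exact hT.2.2.1 (Finset.Subset.antisymm hT.2.1 hRT)

/-- The events `{S = R'}` for distinct `R'` are disjoint. [folklore] -/
theorem pairwiseDisjoint_filter_eq (A : Finset (Fin n)) (o : Fin n) (𝓕 : Finset (Finset (Fin n)))
    (X : Set (BondConfig (Fin n))) :
    (↑𝓕 : Set (Finset (Fin n))).PairwiseDisjoint fun R' =>
      {ω : BondConfig (Fin n) | A.filter (fun a => ω ∈ openConn o a) = R'} ∩ X := by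
  intro R₁ _ R₂ _ hne
  simp only [Function.onFun]
  exact Set.disjoint_left.2 fun ω h₁ h₂ => hne (h₁.1.symm.trans h₂.1)

/-! ### The local induction -/

/-- **Localized laminar lonely relay inequality** (see the module docstring).  Relays pairwise separated with
positive probability; `𝓛` laminar with nonempty members inside `A`; `R ∈ 𝓛`; `𝒜` a finite set of supersets of
`R`.  Then some member `L ⊆ R` satisfies
`Σ_{R' ∈ 𝓛, R' ⊆ R} μ({S = R'} ∩ J(𝒜)) ≤ φ(R) · μ({L ↮ A∖R} ∩ J(𝒜))`.
[cite: KozmaNitzan2024, Lemma 2 (p. 6) — mechanism; VandenbergHaggstromKahn2005, Thm. 2.1 at q = 1] -/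
theorem local_bound (w : Sym2 (Fin n) → unitInterval) (A : Finset (Fin n)) (o : Fin n)
    (𝓛 : Finset (Finset (Fin n))) (hsubA : ∀ R ∈ 𝓛, R ⊆ A) (hne𝓛 : ∀ R ∈ 𝓛, R.Nonempty)
    (hlam : ∀ R ∈ 𝓛, ∀ T ∈ 𝓛, R ⊆ T ∨ T ⊆ R ∨ Disjoint R T)
    (hpos : 0 < (prodBernoulli w).real
      {ω : BondConfig (Fin n) | ∀ x ∈ A, ∀ y ∈ A, x ≠ y → ω ∉ openConn x y}) :
    ∀ (N : ℕ) (R : Finset (Fin n)), R ∈ 𝓛 → (𝓛.filter (fun R' => R' ⊆ R)).card ≤ N →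
      ∀ 𝒜 : Finset (Finset (Fin n)), (∀ Q ∈ 𝒜, R ⊆ Q) →
        ∃ L ∈ 𝓛, L ⊆ R ∧
          ∑ R' ∈ 𝓛.filter (fun R' => R' ⊆ R), (prodBernoulli w).real
              ({ω | A.filter (fun a => ω ∈ openConn o a) = R'} ∩
                {ω | ∀ Q ∈ 𝒜, ∃ q ∈ Q, ∃ y ∈ A \ Q, ω ∈ openConn y q}) ≤
            (prodBernoulli w).real ({ω | ∀ x ∈ R, ∀ y ∈ A \ R, ω ∉ openConn x y} ∩
                {ω | ∃ x ∈ R, ω ∈ openConn o x}) /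
              (prodBernoulli w).real {ω | ∀ x ∈ R, ∀ y ∈ A \ R, ω ∉ openConn x y} *
            (prodBernoulli w).real ({ω | ∀ x ∈ L, ∀ y ∈ A \ R, ω ∉ openConn x y} ∩
                {ω | ∀ Q ∈ 𝒜, ∃ q ∈ Q, ∃ y ∈ A \ Q, ω ∈ openConn y q}) := by
  set μ := prodBernoulli w with hμ
  -- positivity of every `D_R`, `R ⊆ A`
  have hDpos : ∀ R : Finset (Fin n), R ⊆ A →
      0 < μ.real {ω | ∀ x ∈ R, ∀ y ∈ A \ R, ω ∉ openConn x y} := by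
    intro R hRA
    refine lt_of_lt_of_le hpos (measureReal_mono fun ω hω x hx y hy => ?_)
    exact hω x (hRA hx) y (Finset.mem_sdiff.1 hy).1 (fun h => (Finset.mem_sdiff.1 hy).2 (h ▸ hx))
  intro N
  induction N with
  | zero =>
    intro R hR hcard
    have : R ∈ 𝓛.filter (fun R' => R' ⊆ R) := Finset.mem_filter.2 ⟨hR, Finset.Subset.refl R⟩
    have h0 := Finset.card_pos.2 ⟨R, this⟩
    omega
  | succ N ih =>
    intro R hR hcard 𝒜 h𝒜
    have hRA : R ⊆ A := hsubA R hR
    -- notation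
    set J : Set (BondConfig (Fin n)) := {ω | ∀ Q ∈ 𝒜, ∃ q ∈ Q, ∃ y ∈ A \ Q, ω ∈ openConn y q} with hJ
    set DR : Set (BondConfig (Fin n)) := {ω | ∀ x ∈ R, ∀ y ∈ A \ R, ω ∉ openConn x y} with hDR
    set ER : Set (BondConfig (Fin n)) := {ω | ∃ x ∈ R, ω ∈ openConn o x} with hER
    set ND : Set (BondConfig (Fin n)) := {ω | ∃ q ∈ R, ∃ y ∈ A \ R, ω ∈ openConn y q} with hND
    set CH := 𝓛.filter (fun T => T ⊆ R ∧ T ≠ R ∧ ∀ T' ∈ 𝓛, T ⊆ T' → T' ⊆ R → T' ≠ R → T' = T) with hCH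
    set Fev : BondConfig (Fin n) → Finset (Fin n) := fun ω => A.filter (fun a => ω ∈ openConn o a) with hFev
    set φ : Finset (Fin n) → ℝ := fun X => μ.real ({ω | ∀ x ∈ X, ∀ y ∈ A \ X, ω ∉ openConn x y} ∩
        {ω | ∃ x ∈ X, ω ∈ openConn o x}) / μ.real {ω | ∀ x ∈ X, ∀ y ∈ A \ X, ω ∉ openConn x y} with hφ
    have hφ0 : ∀ X, 0 ≤ φ X := fun X => div_nonneg measureReal_nonneg measureReal_nonneg
    have hDRc : DRᶜ = ND := by
      ext ω
      simp only [hDR, hND, Set.mem_compl_iff, Set.mem_setOf_eq, not_forall, not_not, exists_prop]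
      constructor
      · rintro ⟨x, hx, y, hy, h⟩; exact ⟨x, hx, y, hy, SimpleGraph.Reachable.symm h⟩
      · rintro ⟨q, hq, y, hy, h⟩; exact ⟨q, hq, y, hy, SimpleGraph.Reachable.symm h⟩
    have hJ' : {ω : BondConfig (Fin n) | ∀ Q ∈ insert R 𝒜, ∃ q ∈ Q, ∃ y ∈ A \ Q, ω ∈ openConn y q} =
        J ∩ ND := by
      ext ω
      simp only [Finset.forall_mem_insert, Set.mem_setOf_eq, Set.mem_inter_iff, hJ, hND]
      exact ⟨fun h => ⟨h.2, h.1⟩, fun h => ⟨h.2, h.1⟩⟩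
    -- (α) the part on `D_R`
    have hα : ∑ R' ∈ 𝓛.filter (fun R' => R' ⊆ R), μ.real ({ω | Fev ω = R'} ∩ (J ∩ DR)) ≤
        φ R * μ.real (DR ∩ J) := by
      have h1 : ∑ R' ∈ 𝓛.filter (fun R' => R' ⊆ R), μ.real ({ω | Fev ω = R'} ∩ (J ∩ DR)) ≤
          μ.real (DR ∩ (ER ∩ J)) := by
        rw [← measureReal_biUnion_finset (pairwiseDisjoint_filter_eq A o _ (J ∩ DR))
          (fun R' _ => MeasurableSet.of_discrete)]
        refine measureReal_mono (Set.iUnion₂_subset fun R' hR' ω hω => ?_) (measure_ne_top _ _)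
        obtain ⟨hF, hJω, hDω⟩ := hω
        obtain ⟨hR'𝓛, hR'R⟩ := Finset.mem_filter.1 (Finset.mem_coe.1 hR')
        obtain ⟨x, hx⟩ := hne𝓛 R' hR'𝓛
        have hxF : x ∈ Fev ω := by rw [show Fev ω = R' from hF]; exact hx
        exact ⟨hDω, ⟨x, hR'R hx, (Finset.mem_filter.1 hxF).2⟩, hJω⟩
      have h2 := iso_reach_side_le w A R o 𝒜 h𝒜
      have hd := hDpos R hRA
      calc ∑ R' ∈ 𝓛.filter (fun R' => R' ⊆ R), μ.real ({ω | Fev ω = R'} ∩ (J ∩ DR))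
          ≤ μ.real (DR ∩ (ER ∩ J)) := h1
        _ ≤ φ R * μ.real (DR ∩ J) := by
            rw [hφ]; dsimp only
            rw [div_mul_eq_mul_div, le_div_iff₀ hd]
            calc μ.real (DR ∩ (ER ∩ J)) * μ.real DR = μ.real DR * μ.real (DR ∩ (ER ∩ J)) := mul_comm _ _
              _ ≤ μ.real (DR ∩ ER) * μ.real (DR ∩ J) := h2
    -- (β) the part off `D_R`, child by child, by induction
    have hIH : ∀ T ∈ CH, ∃ L ∈ 𝓛, L ⊆ T ∧
        ∑ R' ∈ 𝓛.filter (fun R' => R' ⊆ T), μ.real ({ω | Fev ω = R'} ∩ (J ∩ ND)) ≤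
          φ T * μ.real ({ω | ∀ x ∈ L, ∀ y ∈ A \ R, ω ∉ openConn x y} ∩ (J ∩ ND)) := by
      intro T hT
      obtain ⟨hT𝓛, hTR, hTne, _⟩ := children_mem hT
      have hcardT : (𝓛.filter (fun R' => R' ⊆ T)).card ≤ N := by
        have hss : 𝓛.filter (fun R' => R' ⊆ T) ⊂ 𝓛.filter (fun R' => R' ⊆ R) := by
          refine Finset.ssubset_iff_subset_ne.2 ⟨fun R' hR' => ?_, fun h => hTne ?_⟩
          · have h := Finset.mem_filter.1 hR'
            exact Finset.mem_filter.2 ⟨h.1, h.2.trans hTR⟩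
          · have hRT : R ∈ 𝓛.filter (fun R' => R' ⊆ T) := by
              rw [h]; exact Finset.mem_filter.2 ⟨hR, Finset.Subset.refl R⟩
            exact Finset.Subset.antisymm hTR (Finset.mem_filter.1 hRT).2
        have := Finset.card_lt_card hss
        omega
      obtain ⟨L, hL𝓛, hLT, hbound⟩ := ih T hT𝓛 hcardT (insert R 𝒜)
        (by
          intro Q hQ
          rcases Finset.mem_insert.1 hQ with rfl | hQ
          · exact hTR
          · exact hTR.trans (h𝒜 Q hQ))
      rw [hJ'] at hbound
      refine ⟨L, hL𝓛, hLT, hbound.trans (mul_le_mul_of_nonneg_left (measureReal_mono (fun ω hω => ?_)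
        (measure_ne_top _ _)) (hφ0 T))⟩
      obtain ⟨hD, hJND⟩ := hω
      refine ⟨fun x hx y hy => hD x hx y (Finset.mem_sdiff.2 ⟨(Finset.mem_sdiff.1 hy).1,
        fun hyT => (Finset.mem_sdiff.1 hy).2 (hTR hyT)⟩), hJND⟩
    choose! Lf hLf using hIH
    -- the witness: the child witness with the largest side term, or `R` itself if there are no children
    set c : Finset (Fin n) → ℝ := fun L =>
      μ.real ({ω | ∀ x ∈ L, ∀ y ∈ A \ R, ω ∉ openConn x y} ∩ (J ∩ ND)) with hc
    have hLstar : ∃ L ∈ 𝓛, L ⊆ R ∧ ∀ T ∈ CH, c (Lf T) ≤ c L := by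
      by_cases hCHne : CH.Nonempty
      · obtain ⟨T₀, hT₀, hmax⟩ := Finset.exists_max_image CH (fun T => c (Lf T)) hCHne
        exact ⟨Lf T₀, (hLf T₀ hT₀).1, (hLf T₀ hT₀).2.1.trans (children_mem hT₀).2.1,
          fun T hT => hmax T hT⟩
      · refine ⟨R, hR, Finset.Subset.refl R, fun T hT => absurd ⟨T, hT⟩ hCHne⟩
    obtain ⟨L, hL𝓛, hLR, hLmax⟩ := hLstar
    refine ⟨L, hL𝓛, hLR, ?_⟩
    -- Lemma 2 over the children
    have hCHsub : ∀ T ∈ CH, T ⊆ R := fun T hT => (children_mem hT).2.1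
    have hlemma2 : (∑ T ∈ CH, φ T) * μ.real DR ≤ μ.real (DR ∩ ER) := by
      have hM : 0 < μ.real (DR ∩ {ω | ∀ T ∈ CH, ∀ x ∈ T, ∀ y ∈ A \ T, ω ∉ openConn x y}) := by
        refine lt_of_lt_of_le hpos (measureReal_mono fun ω hω => ⟨fun x hx y hy => ?_, fun T hT x hx y hy => ?_⟩)
        · exact hω x (hRA hx) y (Finset.mem_sdiff.1 hy).1 (fun h => (Finset.mem_sdiff.1 hy).2 (h ▸ hx))
        · exact hω x (hRA (hCHsub T hT hx)) y (Finset.mem_sdiff.1 hy).1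
            (fun h => (Finset.mem_sdiff.1 hy).2 (h ▸ hx))
      exact lemma2_blocks_ratio w A R CH hRA hCHsub (children_disjoint hlam) o hM
    have hsumφ : ∑ T ∈ CH, φ T ≤ φ R := by
      have hd := hDpos R hRA
      rw [hφ]; dsimp only
      rw [le_div_iff₀ hd]
      exact hlemma2
    -- split every term by `D_R`
    have hsplit : ∀ R' ∈ 𝓛.filter (fun R' => R' ⊆ R),
        μ.real ({ω | Fev ω = R'} ∩ J) =
          μ.real ({ω | Fev ω = R'} ∩ (J ∩ DR)) + μ.real ({ω | Fev ω = R'} ∩ (J ∩ ND)) := by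
      intro R' _
      have h := measureReal_inter_add_sdiff (μ := μ) (s := {ω | Fev ω = R'} ∩ J) (t := DR)
        MeasurableSet.of_discrete (measure_ne_top _ _)
      rw [Set.sdiff_eq, hDRc, Set.inter_assoc, Set.inter_assoc] at h
      exact h.symm
    have hRterm : μ.real ({ω | Fev ω = R} ∩ (J ∩ ND)) = 0 := by
      have hsub : {ω | Fev ω = R} ∩ (J ∩ ND) ⊆ (∅ : Set (BondConfig (Fin n))) := by
        rintro ω ⟨hF, -, ⟨q, hq, y, hy, hyq⟩⟩
        have hqF : q ∈ Fev ω := by rw [show Fev ω = R from hF]; exact hq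
        have hyF : y ∈ Fev ω := Finset.mem_filter.2 ⟨(Finset.mem_sdiff.1 hy).1,
          ((Finset.mem_filter.1 hqF).2 : (openGraph ω).Reachable o q).trans (SimpleGraph.Reachable.symm hyq)⟩
        rw [show Fev ω = R from hF] at hyF
        exact (Finset.mem_sdiff.1 hy).2 hyF
      exact le_antisymm ((measureReal_mono hsub (measure_ne_top _ _)).trans (by simp)) measureReal_nonneg
    -- the part off `D_R`
    have hβ : ∑ R' ∈ 𝓛.filter (fun R' => R' ⊆ R), μ.real ({ω | Fev ω = R'} ∩ (J ∩ ND)) ≤ φ R * c L := by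
      rw [sum_sub_eq hlam hne𝓛 hR (fun R' => μ.real ({ω | Fev ω = R'} ∩ (J ∩ ND))), hRterm, zero_add]
      calc ∑ T ∈ CH, ∑ R' ∈ 𝓛.filter (fun R' => R' ⊆ T), μ.real ({ω | Fev ω = R'} ∩ (J ∩ ND))
          ≤ ∑ T ∈ CH, φ T * c (Lf T) := Finset.sum_le_sum fun T hT => (hLf T hT).2.2
        _ ≤ ∑ T ∈ CH, φ T * c L :=
            Finset.sum_le_sum fun T hT => mul_le_mul_of_nonneg_left (hLmax T hT) (hφ0 T)
        _ = (∑ T ∈ CH, φ T) * c L := by rw [Finset.sum_mul]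
        _ ≤ φ R * c L := mul_le_mul_of_nonneg_right hsumφ measureReal_nonneg
    -- recombine
    have hfinal : μ.real (DR ∩ J) + c L =
        μ.real ({ω | ∀ x ∈ L, ∀ y ∈ A \ R, ω ∉ openConn x y} ∩ J) := by
      have h := measureReal_inter_add_sdiff (μ := μ)
        (s := {ω | ∀ x ∈ L, ∀ y ∈ A \ R, ω ∉ openConn x y} ∩ J) (t := DR)
        MeasurableSet.of_discrete (measure_ne_top _ _)
      rw [Set.sdiff_eq, hDRc] at h
      have hDL : {ω | ∀ x ∈ L, ∀ y ∈ A \ R, ω ∉ openConn x y} ∩ J ∩ DR = DR ∩ J := by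
        ext ω
        simp only [Set.mem_inter_iff]
        constructor
        · rintro ⟨⟨-, hJω⟩, hD⟩; exact ⟨hD, hJω⟩
        · rintro ⟨hD, hJω⟩; exact ⟨⟨fun x hx y hy => hD x (hLR hx) y hy, hJω⟩, hD⟩
      rw [hDL, Set.inter_assoc] at h
      rw [hc]
      exact h
    calc ∑ R' ∈ 𝓛.filter (fun R' => R' ⊆ R), μ.real ({ω | Fev ω = R'} ∩ J)
        = ∑ R' ∈ 𝓛.filter (fun R' => R' ⊆ R), (μ.real ({ω | Fev ω = R'} ∩ (J ∩ DR)) +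
            μ.real ({ω | Fev ω = R'} ∩ (J ∩ ND))) := Finset.sum_congr rfl hsplit
      _ = (∑ R' ∈ 𝓛.filter (fun R' => R' ⊆ R), μ.real ({ω | Fev ω = R'} ∩ (J ∩ DR))) +
            ∑ R' ∈ 𝓛.filter (fun R' => R' ⊆ R), μ.real ({ω | Fev ω = R'} ∩ (J ∩ ND)) :=
          Finset.sum_add_distrib
      _ ≤ φ R * μ.real (DR ∩ J) + φ R * c L := add_le_add hα hβ
      _ = φ R * μ.real ({ω | ∀ x ∈ L, ∀ y ∈ A \ R, ω ∉ openConn x y} ∩ J) := by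
          rw [← mul_add, hfinal]

end TwoLevelLonelyRelay

end Summit.CriticalPhenomena.PercolationContinuityZ3.Theorems
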